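import Mathlib.Analysis.Calculus.Deriv.Polynomial
import Mathlib.Analysis.Calculus.Deriv.Inv
import Mathlib.Analysis.SpecialFunctions.Pow.Deriv
import Mathlib.Analysis.SpecialFunctions.Integrability.Basic
import Mathlib.Analysis.SpecialFunctions.Trigonometric.Bounds
import Literature.Analysis.FluidPDE.ElgindiCutoffCalculus
import Literature.Analysis.FluidPDE.ElgindiHkTools
import HarnessLib

/-!
# The `𝓗⁴` tail of Elgindi's explicit profile `F_*`: `D_z`-iterates of the radial factor,
`D_θ`-iterates of `Γ`, and the singular angular integral `∫ Γ² sin(2θ)^{−γ} < ∞`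

Topic `Literature/Analysis/FluidPDE`. Support file (everything proved, no named facts) of the
discharge of the §2.6 datum fact `ElgindiGhoulMasmoudi2021_compactSupportDatum`
(`ElgindiStabilityDecomposition.lean`; Elgindi–Ghoul–Masmoudi, Camb. J. Math. 9 (2021) =
arXiv:1910.14071, §2.6 p. 9: "`‖ε₀^{M,β}‖_{𝓗ᵏ} ≤ C/M^{1/4} + Cβ + Cα²`. This is just due to the fact
that `F = F_* + α²g` and `F_* ≈ αz⁻¹` as `z → ∞` … while the `𝓗ᵏ` norm is like an `L²` norm for
large `z`"). The sentence hides the statement proved here: **every term of the `𝓗⁴` functional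
of `F_*` has a finite integral over the tail `z ≥ 1`** of the quarter strip
(`lintegral_tailSet_one_hkRadialTerm_fundamentalProfile_lt_top`,
`lintegral_tailSet_one_hkMixedTerm_fundamentalProfile_lt_top`), although `F_* ∉ 𝓗⁰` because of
`z → 0`. With `F_* = R ⊗ Γ`, `R(z) = (4α/c) z/(1+z)²`, `Γ(θ) = (sin θ cos²θ)^{α/3}`
(`fundamentalProfile_eq_tensor`) and `D_θ^i D_z^j (R ⊗ Γ) = (Dz₁^j R) ⊗ (Dθ₁^i Γ)`
(`ElgindiCutoffCalculus.lean`), this rests on three elementary facts: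

* `R` and all its `Dz₁`-iterates are polynomials without constant term in `u = (1+z)⁻¹`
  (`Dz₁` acts on `ℝ[u]` as the derivation `u ↦ u² − u`), hence `|Dz₁^j R| ≤ C_j/(1+z)` on `z > 0`
  (`exists_abs_iterate_Dz₁_profileRadial_le`);
* `Dθ₁ Γ = (2α/3)(1 − 3 sin²θ) Γ` on `(0, π/2)`, so `Dθ₁^i Γ = q_i Γ` with `q_i` smooth, and
  `|Dθ₁^i Γ| ≤ Q_i Γ` there (`exists_abs_iterate_Dθ₁_angularWeight_le`);
* **the singular angular integral** `∫₀^{π/2} Γ² sin(2θ)^{−γ} dθ < ∞`, `γ = 1 + α/10`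
  (`lintegral_angularWeight_sq_mul_rpow_lt_top`): the integrand is
  `2^{−γ} (sin θ)^{17α/30 − 1} (cos θ)^{37α/30 − 1}`, compared with `θ^{p}` and `(π/2 − θ)^{q}`,
  `p, q > −1`, through Jordan's inequality `sin θ ≥ (2/π)θ`. This is where Elgindi's choice
  `γ = 1 + α/10` (just above `1`, [Elgindi2021] §1.7.1) is used: the weight `sin(2θ)^{−γ/2}` of the
  mixed terms is exactly as singular as `Γ ∼ θ^{α/3}` allows.

Then on `z ≥ 1` each term is `≤ (16 C_j²/(1+z)²) · (Q_i² Γ² sin(2θ)^{−γ}/… )`, a product of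
integrable functions of `z` and of `θ` (Tonelli). Folklore calculus throughout; the objects are
those of [ElgindiGhoulMasmoudi2021] §1.7 and §2.3. Used from Mathlib: `Polynomial.hasDerivAt`,
`HasDerivAt.rpow_const`, `Real.mul_le_sin`, `intervalIntegral.intervalIntegrable_rpow'`,
`IntervalIntegrable.comp_sub_left`, `MeasureTheory.lintegral_prod_mul`, `Measure.prod_restrict`.
-/

noncomputable section

open MeasureTheory Set Function Real Filter
open _root_.Topology
open scoped ENNReal Polynomial

namespace Literature.Analysis.FluidPDE

namespace Elgindi

/-! ### Polynomials in `u = (1+z)⁻¹` under `Dz₁` -/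

/-- **`Dz₁` on polynomials in `u = (1+z)⁻¹`**: if `f(z) = P(u)` on `z > 0` then
`Dz₁ f (z) = ((u² − u)P'(u))` there (`z · d/dz` acts on `ℝ[u]` as the derivation `u ↦ u² − u`,
since `z u' = −z/(1+z)² = u² − u`). [folklore] -/
theorem Dz₁_eq_eval_of_eq_eval {f : ℝ → ℝ} {P : ℝ[X]}
    (hf : ∀ z, 0 < z → f z = P.eval (1 + z)⁻¹) {z : ℝ} (hz : 0 < z) :
    Dz₁ f z = ((Polynomial.X ^ 2 - Polynomial.X) * Polynomial.derivative P).eval (1 + z)⁻¹ := by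
  have hz1 : (1 + z) ≠ 0 := by positivity
  have hfe : f =ᶠ[𝓝 z] fun y => P.eval (1 + y)⁻¹ := by
    filter_upwards [isOpen_Ioi.mem_nhds hz] with y hy using hf y hy
  have hu : HasDerivAt (fun y : ℝ => (1 + y)⁻¹) (-(1 : ℝ) / (1 + z) ^ 2) z :=
    ((hasDerivAt_id' z).const_add 1).fun_inv hz1
  have hP := (Polynomial.hasDerivAt P ((1 + z)⁻¹)).comp z hu
  rw [Dz₁_apply, hfe.deriv_eq,
    show (fun y : ℝ => P.eval (1 + y)⁻¹) = ((fun x : ℝ => P.eval x) ∘ fun y : ℝ => (1 + y)⁻¹)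
      from rfl, hP.deriv]
  simp only [Polynomial.eval_mul, Polynomial.eval_sub, Polynomial.eval_pow, Polynomial.eval_X]
  field_simp
  ring

/-- Iterating: all `Dz₁`-iterates of such an `f` are again polynomials in `u` without constant
term (the ideal `uℝ[u]` is stable under `u ↦ u² − u` times the derivative). [folklore] -/
theorem exists_iterate_Dz₁_eq_eval {f : ℝ → ℝ} {P : ℝ[X]} (hP : P.eval 0 = 0)
    (hf : ∀ z, 0 < z → f z = P.eval (1 + z)⁻¹) (j : ℕ) :
    ∃ Q : ℝ[X], Q.eval 0 = 0 ∧ ∀ z, 0 < z → Dz₁^[j] f z = Q.eval (1 + z)⁻¹ := by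
  induction j with
  | zero => exact ⟨P, hP, hf⟩
  | succ j ih =>
    obtain ⟨Q, -, hQ⟩ := ih
    refine ⟨(Polynomial.X ^ 2 - Polynomial.X) * Polynomial.derivative Q, by simp, fun z hz => ?_⟩
    rw [iterate_succ_apply']
    exact Dz₁_eq_eval_of_eq_eval hQ hz

/-- A polynomial without constant term is `O(u)` on `[0, 1]`: `|Q(u)| ≤ (∑|coeff|) u`. [folklore] -/
theorem exists_abs_eval_le_mul {Q : ℝ[X]} (hQ : Q.eval 0 = 0) :
    ∃ C : ℝ, 0 ≤ C ∧ ∀ u, 0 ≤ u → u ≤ 1 → |Q.eval u| ≤ C * u := by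
  refine ⟨∑ i ∈ Finset.range (Q.natDegree + 1), |Q.coeff i|,
    Finset.sum_nonneg fun i _ => abs_nonneg _, fun u hu0 hu1 => ?_⟩
  rw [Polynomial.eval_eq_sum_range, Finset.sum_mul]
  refine (Finset.abs_sum_le_sum_abs _ _).trans (Finset.sum_le_sum fun i _ => ?_)
  rcases Nat.eq_zero_or_pos i with h | h
  · subst h
    have h0 : Q.coeff 0 = 0 := by rw [Polynomial.coeff_zero_eq_eval_zero, hQ]
    simp [h0]
  · rw [abs_mul, abs_of_nonneg (pow_nonneg hu0 _)]
    refine mul_le_mul_of_nonneg_left ?_ (abs_nonneg _)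
    simpa using pow_le_pow_of_le_one hu0 hu1 (Nat.succ_le_of_lt h)

/-! ### The radial factor of `F_*` and its `Dz₁`-iterates -/

/-- The radial factor `R(z) = (4α/c) · z/(1+z)²` of `F_* = R ⊗ Γ` (Elgindi–Ghoul–Masmoudi 2021,
§2.3: `F_* = (Γ/c) 4αz/(1+z)²`). [cite: ElgindiGhoulMasmoudi2021, §2.3 (p. 7 of arXiv:1910.14071): F_* = (Γ/c)·4αz/(1+z)²] -/
def profileRadial (α : ℝ) (z : ℝ) : ℝ :=
  4 * α / profileConst α * (z / (1 + z) ^ 2)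

/-- `F_* = R ⊗ Γ`. [folklore] -/
theorem fundamentalProfile_eq_tensor (α : ℝ) :
    fundamentalProfile α = tensor (profileRadial α) (angularWeight α) := by
  funext z θ
  simp only [fundamentalProfile, tensor_apply, profileRadial]
  ring

/-- `R(z) = (4α/c)(u − u²)` with `u = (1+z)⁻¹`, for `z > 0`. [folklore] -/
theorem profileRadial_eq_eval (α : ℝ) {z : ℝ} (hz : 0 < z) :
    profileRadial α z =
      (Polynomial.C (4 * α / profileConst α) * (Polynomial.X - Polynomial.X ^ 2)).eval (1 + z)⁻¹ := by
  have hz1 : (1 + z) ≠ 0 := by positivity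
  have e : z / (1 + z) ^ 2 = (1 + z)⁻¹ - ((1 + z)⁻¹) ^ 2 := by
    field_simp
    ring
  simp only [Polynomial.eval_mul, Polynomial.eval_C, Polynomial.eval_sub, Polynomial.eval_X,
    Polynomial.eval_pow, profileRadial, e]

/-- **`|Dz₁^j R(z)| ≤ C_j/(1+z)` on `z > 0`** (`F_* ≈ αz⁻¹` as `z → ∞`, with all its scaling
derivatives; Elgindi–Ghoul–Masmoudi 2021, §2.6). [cite: ElgindiGhoulMasmoudi2021, §2.6 (p. 9 of arXiv:1910.14071): F_* ≈ αz⁻¹ as z → ∞] -/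
theorem exists_abs_iterate_Dz₁_profileRadial_le (α : ℝ) (j : ℕ) :
    ∃ C : ℝ, 0 ≤ C ∧ ∀ z, 0 < z → |Dz₁^[j] (profileRadial α) z| ≤ C / (1 + z) := by
  obtain ⟨Q, hQ0, hQ⟩ := exists_iterate_Dz₁_eq_eval (f := profileRadial α)
    (P := Polynomial.C (4 * α / profileConst α) * (Polynomial.X - Polynomial.X ^ 2)) (by simp)
    (fun z hz => profileRadial_eq_eval α hz) j
  obtain ⟨C, hC0, hC⟩ := exists_abs_eval_le_mul hQ0
  refine ⟨C, hC0, fun z hz => ?_⟩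
  rw [hQ z hz, div_eq_mul_inv]
  exact hC _ (inv_nonneg.2 (by positivity)) (inv_le_one_of_one_le₀ (by linarith))

/-! ### `D_θ`-iterates of `Γ` -/

/-- The derivative of `Γ(θ) = (sin θ cos²θ)^{α/3}` inside the quarter. [folklore] -/
theorem hasDerivAt_angularWeight (α : ℝ) {θ : ℝ} (hθ : θ ∈ Ioo 0 (π / 2)) :
    HasDerivAt (angularWeight α)
      ((Real.cos θ * Real.cos θ ^ 2 + Real.sin θ * (2 * Real.cos θ ^ (2 - 1) * -Real.sin θ)) *
        (α / 3) * (Real.sin θ * Real.cos θ ^ 2) ^ (α / 3 - 1)) θ := by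
  have hs : 0 < Real.sin θ := Real.sin_pos_of_pos_of_lt_pi hθ.1 (by linarith [hθ.2, pi_pos])
  have hc : 0 < Real.cos θ := Real.cos_pos_of_mem_Ioo ⟨by linarith [hθ.1, pi_pos], hθ.2⟩
  have hu : HasDerivAt (fun θ => Real.sin θ * Real.cos θ ^ 2)
      (Real.cos θ * Real.cos θ ^ 2 + Real.sin θ * (2 * Real.cos θ ^ (2 - 1) * -Real.sin θ)) θ := by
    have h2 : HasDerivAt (fun θ => Real.cos θ ^ 2) ((2 : ℕ) * Real.cos θ ^ (2 - 1) * -Real.sin θ) θ :=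
      (Real.hasDerivAt_cos θ).fun_pow 2
    have h := (Real.hasDerivAt_sin θ).mul h2
    exact_mod_cast h
  unfold angularWeight
  exact hu.rpow_const (Or.inl (by positivity))

/-- **`sin(2θ) Γ' = (2α/3)(1 − 3sin²θ) Γ`** inside the quarter: `D_θ Γ` is a bounded smooth
multiple of `Γ`. [folklore] -/
theorem sin_two_mul_mul_deriv_angularWeight (α : ℝ) {θ : ℝ} (hθ : θ ∈ Ioo 0 (π / 2)) :
    Real.sin (2 * θ) * deriv (angularWeight α) θ =
      2 * α / 3 * (1 - 3 * Real.sin θ ^ 2) * angularWeight α θ := by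
  have hs : 0 < Real.sin θ := Real.sin_pos_of_pos_of_lt_pi hθ.1 (by linarith [hθ.2, pi_pos])
  have hc : 0 < Real.cos θ := Real.cos_pos_of_mem_Ioo ⟨by linarith [hθ.1, pi_pos], hθ.2⟩
  have hs0 : Real.sin θ ≠ 0 := hs.ne'
  have hc0 : Real.cos θ ≠ 0 := hc.ne'
  have hu0 : Real.sin θ * Real.cos θ ^ 2 ≠ 0 := by positivity
  rw [(hasDerivAt_angularWeight α hθ).deriv, Real.rpow_sub_one hu0,
    show (Real.sin θ * Real.cos θ ^ 2) ^ (α / 3) = angularWeight α θ from rfl, Real.sin_two_mul]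
  have key : Real.cos θ ^ 2 = 1 - Real.sin θ ^ 2 := by rw [Real.cos_sq']
  have e : 2 * Real.sin θ * Real.cos θ *
      ((Real.cos θ * Real.cos θ ^ 2 + Real.sin θ * (2 * Real.cos θ ^ (2 - 1) * -Real.sin θ)) *
        (α / 3) * (angularWeight α θ / (Real.sin θ * Real.cos θ ^ 2))) =
      2 * α / 3 * (Real.cos θ ^ 2 - 2 * Real.sin θ ^ 2) * angularWeight α θ := by
    field_simp
    ring
  rw [e, key]
  ring

/-- The product rule behind the iteration: if `g = q Γ` on the open quarter with `q`
differentiable, then `Dθ₁ g = (sin(2θ) q' + (2α/3)(1 − 3sin²θ) q) Γ` there. [folklore] -/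
theorem Dθ₁_eq_of_eq_mul_angularWeight {α : ℝ} {q g : ℝ → ℝ} (hq : Differentiable ℝ q)
    (hg : ∀ θ ∈ Ioo 0 (π / 2), g θ = q θ * angularWeight α θ) {θ : ℝ} (hθ : θ ∈ Ioo 0 (π / 2)) :
    Dθ₁ g θ = (Real.sin (2 * θ) * deriv q θ + 2 * α / 3 * (1 - 3 * Real.sin θ ^ 2) * q θ) *
      angularWeight α θ := by
  have hge : g =ᶠ[𝓝 θ] fun θ => q θ * angularWeight α θ := by
    filter_upwards [isOpen_Ioo.mem_nhds hθ] with y hy using hg y hy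
  have hprod : HasDerivAt (fun θ => q θ * angularWeight α θ)
      (deriv q θ * angularWeight α θ + q θ * deriv (angularWeight α) θ) θ :=
    (hq θ).hasDerivAt.mul (hasDerivAt_angularWeight α hθ).differentiableAt.hasDerivAt
  rw [Dθ₁_apply, hge.deriv_eq, hprod.deriv]
  have key := sin_two_mul_mul_deriv_angularWeight α hθ
  linear_combination (q θ) * key

/-- **`Dθ₁^i Γ = q_i Γ` on the open quarter with `q_i` smooth** (`q₀ = 1`,
`q_{i+1} = sin(2θ) q_i' + (2α/3)(1 − 3sin²θ) q_i`). [folklore] -/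
theorem exists_iterate_Dθ₁_angularWeight_eq (α : ℝ) (i : ℕ) :
    ∃ q : ℝ → ℝ, (∀ n : ℕ, ContDiff ℝ n q) ∧
      ∀ θ ∈ Ioo 0 (π / 2), Dθ₁^[i] (angularWeight α) θ = q θ * angularWeight α θ := by
  induction i with
  | zero => exact ⟨fun _ => 1, fun n => contDiff_const, fun θ _ => by simp⟩
  | succ i ih =>
    obtain ⟨q, hq, hqe⟩ := ih
    refine ⟨fun θ => Real.sin (2 * θ) * deriv q θ + 2 * α / 3 * (1 - 3 * Real.sin θ ^ 2) * q θ,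
      fun n => ?_, fun θ hθ => ?_⟩
    · have h0 : ContDiff ℝ ((n : WithTop ℕ∞) + 1) q := by exact_mod_cast hq (n + 1)
      have h1 : ContDiff ℝ n (deriv q) := h0.deriv'
      have h2 : ContDiff ℝ n q := hq n
      have h3 : ContDiff ℝ n (fun θ : ℝ => Real.sin (2 * θ)) := by fun_prop
      have h4 : ContDiff ℝ n (fun θ : ℝ => 2 * α / 3 * (1 - 3 * Real.sin θ ^ 2)) := by fun_prop
      exact (h3.mul h1).add (h4.mul h2)
    · rw [iterate_succ_apply']
      exact Dθ₁_eq_of_eq_mul_angularWeight ((hq 1).differentiable (by norm_num)) hqe hθ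

/-- **`|Dθ₁^i Γ| ≤ Q_i Γ` on the open quarter** (`q_i` is continuous on the compact `[0, π/2]`). [folklore] -/
theorem exists_abs_iterate_Dθ₁_angularWeight_le (α : ℝ) (i : ℕ) :
    ∃ Q : ℝ, 0 ≤ Q ∧ ∀ θ ∈ Ioo 0 (π / 2),
      |Dθ₁^[i] (angularWeight α) θ| ≤ Q * angularWeight α θ := by
  obtain ⟨q, hq, hqe⟩ := exists_iterate_Dθ₁_angularWeight_eq α i
  obtain ⟨C, hC⟩ := isCompact_Icc.exists_bound_of_continuousOn
    ((hq 0).continuous.continuousOn (s := Icc 0 (π / 2)))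
  refine ⟨max C 0, le_max_right _ _, fun θ hθ => ?_⟩
  have hΓ := angularWeight_nonneg α (Ioo_subset_Icc_self hθ)
  rw [hqe θ hθ, abs_mul, abs_of_nonneg hΓ]
  refine mul_le_mul_of_nonneg_right ?_ hΓ
  exact ((Real.norm_eq_abs _).symm.le.trans (hC θ (Ioo_subset_Icc_self hθ))).trans (le_max_left _ _)

/-! ### The singular angular integral `∫₀^{π/2} Γ² sin(2θ)^{−γ} dθ < ∞` -/

/-- On `(0, 1]`, `x ^ r ≤ x⁻¹` for `r > −1`. [folklore] -/
theorem rpow_le_inv_of_le_one {x r : ℝ} (hx : 0 < x) (hx1 : x ≤ 1) (hr : -1 < r) : x ^ r ≤ x⁻¹ := by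
  rw [← Real.rpow_neg_one]
  exact Real.rpow_le_rpow_of_exponent_ge hx hx1 hr.le

/-- **Jordan's inequality in `rpow` form**: `(sin θ)^r ≤ (π/2) θ^{min(r,0)}` on `(0, π/2)` for
`r > −1` (`sin θ ≥ (2/π)θ`, and `(2/π)^{min(r,0)} ≤ (2/π)^{−1}`). [folklore] -/
theorem sin_rpow_le {θ r : ℝ} (hθ : θ ∈ Ioo 0 (π / 2)) (hr : -1 < r) :
    Real.sin θ ^ r ≤ π / 2 * θ ^ min r 0 := by
  have hs : 0 < Real.sin θ := Real.sin_pos_of_pos_of_lt_pi hθ.1 (by linarith [hθ.2, pi_pos])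
  have h1 : Real.sin θ ^ r ≤ Real.sin θ ^ min r 0 :=
    Real.rpow_le_rpow_of_exponent_ge hs (Real.sin_le_one θ) (min_le_left _ _)
  have hJ : 2 / π * θ ≤ Real.sin θ := Real.mul_le_sin hθ.1.le hθ.2.le
  have hθpos : 0 < 2 / π * θ := by have := hθ.1; positivity
  have h2 : Real.sin θ ^ min r 0 ≤ (2 / π * θ) ^ min r 0 :=
    Real.rpow_le_rpow_of_nonpos hθpos hJ (min_le_right _ _)
  have h3 : (2 / π * θ) ^ min r 0 = (2 / π) ^ min r 0 * θ ^ min r 0 :=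
    Real.mul_rpow (by positivity) hθ.1.le
  have h4 : (2 / π) ^ min r 0 ≤ π / 2 := by
    have hle : (2 / π : ℝ) ≤ 1 := by
      rw [div_le_one pi_pos]
      exact Real.two_le_pi
    calc (2 / π) ^ min r 0 ≤ (2 / π) ^ (-1 : ℝ) :=
          Real.rpow_le_rpow_of_exponent_ge (by positivity) hle (le_min hr.le (by norm_num))
      _ = π / 2 := by rw [Real.rpow_neg_one, inv_div]
  calc Real.sin θ ^ r ≤ Real.sin θ ^ min r 0 := h1
    _ ≤ (2 / π * θ) ^ min r 0 := h2
    _ = (2 / π) ^ min r 0 * θ ^ min r 0 := h3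
    _ ≤ π / 2 * θ ^ min r 0 := mul_le_mul_of_nonneg_right h4 (Real.rpow_nonneg hθ.1.le _)

/-- The mirror image: `(cos θ)^r ≤ (π/2) (π/2 − θ)^{min(r,0)}` on `(0, π/2)` for `r > −1`. [folklore] -/
theorem cos_rpow_le {θ r : ℝ} (hθ : θ ∈ Ioo 0 (π / 2)) (hr : -1 < r) :
    Real.cos θ ^ r ≤ π / 2 * (π / 2 - θ) ^ min r 0 := by
  have hθ' : π / 2 - θ ∈ Ioo 0 (π / 2) := ⟨by linarith [hθ.2], by linarith [hθ.1]⟩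
  rw [← Real.sin_pi_div_two_sub]
  exact sin_rpow_le hθ' hr

/-- **Pointwise bound for the singular angular integrand**:
`Γ(θ)² sin(2θ)^{−γ} ≤ π (θ^{m₁} + (π/2 − θ)^{m₂})` on `(0, π/2)`, with
`m₁ = min(2α/3 − γ, 0)`, `m₂ = min(4α/3 − γ, 0)`, both `> −1` (`γ = 1 + α/10`). [folklore] -/
theorem angularWeight_sq_mul_rpow_le {α : ℝ} (hα : 0 < α) {θ : ℝ} (hθ : θ ∈ Ioo 0 (π / 2)) :
    angularWeight α θ ^ 2 * Real.sin (2 * θ) ^ (-gammaExp α) ≤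
      π * (θ ^ min (2 * α / 3 - gammaExp α) 0 + (π / 2 - θ) ^ min (4 * α / 3 - gammaExp α) 0) := by
  set γ := gammaExp α with hγ
  have hs : 0 < Real.sin θ := Real.sin_pos_of_pos_of_lt_pi hθ.1 (by linarith [hθ.2, pi_pos])
  have hc : 0 < Real.cos θ := Real.cos_pos_of_mem_Ioo ⟨by linarith [hθ.1, pi_pos], hθ.2⟩
  have hs1 : Real.sin θ ≤ 1 := Real.sin_le_one θ
  have hc1 : Real.cos θ ≤ 1 := Real.cos_le_one θ
  have hp : -1 < 2 * α / 3 - γ := by rw [hγ, gammaExp]; linarith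
  have hq : -1 < 4 * α / 3 - γ := by rw [hγ, gammaExp]; linarith
  have hγ0 : 0 ≤ γ := by rw [hγ, gammaExp]; linarith
  -- the integrand as a product of powers of `sin θ` and `cos θ`
  have e1 : angularWeight α θ ^ 2 = Real.sin θ ^ (2 * α / 3) * Real.cos θ ^ (4 * α / 3) := by
    unfold angularWeight
    rw [← Real.rpow_natCast ((Real.sin θ * Real.cos θ ^ 2) ^ (α / 3)) 2,
      ← Real.rpow_mul (by positivity), Real.mul_rpow hs.le (by positivity),
      ← Real.rpow_natCast (Real.cos θ) 2, ← Real.rpow_mul hc.le]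
    congr 1
    · norm_num; ring_nf
    · norm_num; ring_nf
  have e2 : Real.sin (2 * θ) ^ (-γ) =
      (2 : ℝ) ^ (-γ) * Real.sin θ ^ (-γ) * Real.cos θ ^ (-γ) := by
    rw [Real.sin_two_mul, Real.mul_rpow (by positivity) hc.le, Real.mul_rpow (by norm_num) hs.le]
  have e3 : angularWeight α θ ^ 2 * Real.sin (2 * θ) ^ (-γ) =
      (2 : ℝ) ^ (-γ) * (Real.sin θ ^ (2 * α / 3 - γ) * Real.cos θ ^ (4 * α / 3 - γ)) := by
    rw [e1, e2, sub_eq_add_neg, sub_eq_add_neg, Real.rpow_add hs, Real.rpow_add hc]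
    ring
  rw [e3]
  have h2γ : (2 : ℝ) ^ (-γ) ≤ 1 := Real.rpow_le_one_of_one_le_of_nonpos (by norm_num) (by linarith)
  have b1 := sin_rpow_le hθ hp
  have b2 := cos_rpow_le hθ hq
  have b3 : Real.sin θ ^ (2 * α / 3 - γ) ≤ (Real.sin θ)⁻¹ := rpow_le_inv_of_le_one hs hs1 hp
  have b4 : Real.cos θ ^ (4 * α / 3 - γ) ≤ (Real.cos θ)⁻¹ := rpow_le_inv_of_le_one hc hc1 hq
  have n1 : 0 ≤ θ ^ min (2 * α / 3 - γ) 0 := Real.rpow_nonneg hθ.1.le _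
  have n2 : 0 ≤ (π / 2 - θ) ^ min (4 * α / 3 - γ) 0 := Real.rpow_nonneg (by linarith [hθ.2]) _
  have ns : 0 ≤ Real.sin θ ^ (2 * α / 3 - γ) := Real.rpow_nonneg hs.le _
  have nc : 0 ≤ Real.cos θ ^ (4 * α / 3 - γ) := Real.rpow_nonneg hc.le _
  rcases le_or_gt θ (π / 4) with h | h
  · -- near `θ = 0`: `cos θ ≥ 1/2`
    have hc2 : (Real.cos θ)⁻¹ ≤ 2 := by
      have : 1 / 2 ≤ Real.cos θ := by
        rw [← Real.cos_pi_div_three]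
        exact Real.cos_le_cos_of_nonneg_of_le_pi hθ.1.le (by linarith [pi_pos]) (by linarith [pi_pos])
      rw [inv_le_comm₀ hc (by norm_num)]
      linarith
    have hprod : Real.sin θ ^ (2 * α / 3 - γ) * Real.cos θ ^ (4 * α / 3 - γ) ≤
        π / 2 * θ ^ min (2 * α / 3 - γ) 0 * 2 :=
      mul_le_mul b1 (b4.trans hc2) nc (by positivity)
    calc (2 : ℝ) ^ (-γ) * (Real.sin θ ^ (2 * α / 3 - γ) * Real.cos θ ^ (4 * α / 3 - γ))
        ≤ 1 * (π / 2 * θ ^ min (2 * α / 3 - γ) 0 * 2) :=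
          mul_le_mul h2γ hprod (mul_nonneg ns nc) zero_le_one
      _ ≤ π * (θ ^ min (2 * α / 3 - γ) 0 + (π / 2 - θ) ^ min (4 * α / 3 - γ) 0) := by
          nlinarith [pi_pos]
  · -- near `θ = π/2`: `sin θ ≥ 1/2`
    have hs2 : (Real.sin θ)⁻¹ ≤ 2 := by
      have : 1 / 2 ≤ Real.sin θ := by
        rw [← Real.sin_pi_div_six]
        exact Real.sin_le_sin_of_le_of_le_pi_div_two (by linarith [pi_pos]) hθ.2.le
          (by linarith [pi_pos])
      rw [inv_le_comm₀ hs (by norm_num)]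
      linarith
    have hprod : Real.sin θ ^ (2 * α / 3 - γ) * Real.cos θ ^ (4 * α / 3 - γ) ≤
        2 * (π / 2 * (π / 2 - θ) ^ min (4 * α / 3 - γ) 0) :=
      mul_le_mul (b3.trans hs2) b2 nc (by norm_num)
    calc (2 : ℝ) ^ (-γ) * (Real.sin θ ^ (2 * α / 3 - γ) * Real.cos θ ^ (4 * α / 3 - γ))
        ≤ 1 * (2 * (π / 2 * (π / 2 - θ) ^ min (4 * α / 3 - γ) 0)) :=
          mul_le_mul h2γ hprod (mul_nonneg ns nc) zero_le_one
      _ ≤ π * (θ ^ min (2 * α / 3 - γ) 0 + (π / 2 - θ) ^ min (4 * α / 3 - γ) 0) := by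
          nlinarith [pi_pos]

/-- `ofReal x ≤ ‖x‖ₑ` for real `x`. [folklore] -/
theorem ofReal_le_enorm_real (x : ℝ) : ENNReal.ofReal x ≤ ‖x‖ₑ := by
  rw [Real.enorm_eq_ofReal_abs]
  exact ENNReal.ofReal_le_ofReal (le_abs_self x)

/-- `∫⁻_{(0,π/2)} θ^r < ∞` for `r > −1`. [folklore] -/
theorem lintegral_Ioo_rpow_lt_top {r : ℝ} (hr : -1 < r) :
    ∫⁻ θ in Ioo (0 : ℝ) (π / 2), ENNReal.ofReal (θ ^ r) < ∞ := by
  have hi : IntegrableOn (fun θ : ℝ => θ ^ r) (Ioo 0 (π / 2)) := by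
    have h := intervalIntegral.intervalIntegrable_rpow' hr (a := 0) (b := π / 2)
    rw [intervalIntegrable_iff_integrableOn_Ioc_of_le (by positivity)] at h
    exact h.mono_set Ioo_subset_Ioc_self
  exact lt_of_le_of_lt (lintegral_mono fun θ => ofReal_le_enorm_real _) hi.2

/-- `∫⁻_{(0,π/2)} (π/2 − θ)^r < ∞` for `r > −1`. [folklore] -/
theorem lintegral_Ioo_sub_rpow_lt_top {r : ℝ} (hr : -1 < r) :
    ∫⁻ θ in Ioo (0 : ℝ) (π / 2), ENNReal.ofReal ((π / 2 - θ) ^ r) < ∞ := by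
  have hi : IntegrableOn (fun θ : ℝ => (π / 2 - θ) ^ r) (Ioo 0 (π / 2)) := by
    have h := (intervalIntegral.intervalIntegrable_rpow' hr (a := 0) (b := π / 2)).comp_sub_left
      (π / 2)
    simp only [sub_zero, sub_self] at h
    have h' := h.symm
    rw [intervalIntegrable_iff_integrableOn_Ioc_of_le (by positivity)] at h'
    exact h'.mono_set Ioo_subset_Ioc_self
  exact lt_of_le_of_lt (lintegral_mono fun θ => ofReal_le_enorm_real _) hi.2

/-- **The singular angular integral is finite**: `∫₀^{π/2} Γ(θ)² sin(2θ)^{−γ} dθ < ∞` for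
`α > 0`, `γ = 1 + α/10` (the weight `sin(2θ)^{−γ/2}` of the mixed `𝓗ᵏ` terms against
`Γ ∼ θ^{α/3}`; the reason for Elgindi's `γ = 1 + α/10`). [folklore] -/
theorem lintegral_angularWeight_sq_mul_rpow_lt_top {α : ℝ} (hα : 0 < α) :
    ∫⁻ θ in Ioo (0 : ℝ) (π / 2),
      ENNReal.ofReal (angularWeight α θ ^ 2 * Real.sin (2 * θ) ^ (-gammaExp α)) < ∞ := by
  set m₁ := min (2 * α / 3 - gammaExp α) 0 with hm₁
  set m₂ := min (4 * α / 3 - gammaExp α) 0 with hm₂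
  have h₁ : -1 < m₁ := lt_min (by unfold gammaExp; linarith) (by norm_num)
  have h₂ : -1 < m₂ := lt_min (by unfold gammaExp; linarith) (by norm_num)
  have hmeas : AEMeasurable (fun θ : ℝ => ENNReal.ofReal π * ENNReal.ofReal (θ ^ m₁))
      (volume.restrict (Ioo (0 : ℝ) (π / 2))) :=
    ((measurable_id.pow_const m₁).ennreal_ofReal.const_mul _).aemeasurable
  calc ∫⁻ θ in Ioo (0 : ℝ) (π / 2),
        ENNReal.ofReal (angularWeight α θ ^ 2 * Real.sin (2 * θ) ^ (-gammaExp α))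
      ≤ ∫⁻ θ in Ioo (0 : ℝ) (π / 2), (ENNReal.ofReal π * ENNReal.ofReal (θ ^ m₁) +
          ENNReal.ofReal π * ENNReal.ofReal ((π / 2 - θ) ^ m₂)) := by
        refine setLIntegral_mono' measurableSet_Ioo fun θ hθ => ?_
        have n1 : 0 ≤ θ ^ m₁ := Real.rpow_nonneg hθ.1.le _
        have n2 : 0 ≤ (π / 2 - θ) ^ m₂ := Real.rpow_nonneg (by linarith [hθ.2]) _
        calc ENNReal.ofReal (angularWeight α θ ^ 2 * Real.sin (2 * θ) ^ (-gammaExp α))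
            ≤ ENNReal.ofReal (π * (θ ^ m₁ + (π / 2 - θ) ^ m₂)) :=
              ENNReal.ofReal_le_ofReal (angularWeight_sq_mul_rpow_le hα hθ)
          _ = _ := by
              rw [mul_add, ENNReal.ofReal_add (by positivity) (by positivity),
                ENNReal.ofReal_mul pi_pos.le, ENNReal.ofReal_mul pi_pos.le]
    _ = (ENNReal.ofReal π * ∫⁻ θ in Ioo (0 : ℝ) (π / 2), ENNReal.ofReal (θ ^ m₁)) +
          ENNReal.ofReal π * ∫⁻ θ in Ioo (0 : ℝ) (π / 2), ENNReal.ofReal ((π / 2 - θ) ^ m₂) := by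
        rw [lintegral_add_left' hmeas, lintegral_const_mul' _ _ ENNReal.ofReal_ne_top,
          lintegral_const_mul' _ _ ENNReal.ofReal_ne_top]
    _ < ∞ := ENNReal.add_lt_top.2
        ⟨ENNReal.mul_lt_top ENNReal.ofReal_lt_top (lintegral_Ioo_rpow_lt_top h₁),
          ENNReal.mul_lt_top ENNReal.ofReal_lt_top (lintegral_Ioo_sub_rpow_lt_top h₂)⟩

/-! ### The `𝓗⁴` tail of `F_*` on `z ≥ 1` -/

/-- `w(z) = (1+z)²/z² ≤ 4` for `z ≥ 1`. [folklore] -/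
theorem radialWeight_le_four {z : ℝ} (hz : 1 ≤ z) : radialWeight z ≤ 4 := by
  unfold radialWeight
  rw [div_le_iff₀ (by positivity)]
  nlinarith

/-- **Finite `z ≥ 1` tails of the weighted iterates of `F_*`.** For any weight `ω` with
`ω² ≤ w(z)² sin(2θ)^{−γ}` on the strip (both the `𝓗⁰` weight `w/sin^{η/2}(2θ)` and the mixed
weight `W = w sin(2θ)^{−γ/2}` qualify), `∫∫_{z ≥ 1} |D_θ^i D_z^j F_* · ω|² < ∞`: on `z ≥ 1` the
integrand is at most `(16C_j²/(1+z)²)(Q_i²Γ²sin(2θ)^{−γ})`, a product of integrable functions of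
`z` and `θ` (Elgindi–Ghoul–Masmoudi 2021, §2.6: "`F_* ≈ αz⁻¹` as `z → ∞` … the `𝓗ᵏ` norm is like
an `L²` norm for large `z`"). [cite: ElgindiGhoulMasmoudi2021, §2.6 (p. 9 of arXiv:1910.14071)] -/
theorem lintegral_tailSet_one_iterate_fundamentalProfile_lt_top {α : ℝ} (hα : 0 < α) (i j : ℕ)
    {ω : ℝ → ℝ → ℝ}
    (hω : ∀ p ∈ strip, ω p.1 p.2 ^ 2 ≤ radialWeight p.1 ^ 2 * Real.sin (2 * p.2) ^ (-gammaExp α)) :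
    ∫⁻ p in tailSet 1, ‖Dθ^[i] (Dz^[j] (fundamentalProfile α)) p.1 p.2 * ω p.1 p.2‖ₑ ^ 2 < ∞ := by
  obtain ⟨CR, hCR0, hCR⟩ := exists_abs_iterate_Dz₁_profileRadial_le α j
  obtain ⟨Q, hQ0, hQ⟩ := exists_abs_iterate_Dθ₁_angularWeight_le α i
  rw [fundamentalProfile_eq_tensor, iterate_Dθ_Dz_tensor]
  -- the dominating product
  have hpt : ∀ p ∈ tailSet 1,
      ‖tensor (Dz₁^[j] (profileRadial α)) (Dθ₁^[i] (angularWeight α)) p.1 p.2 * ω p.1 p.2‖ₑ ^ 2 ≤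
        ENNReal.ofReal (16 * CR ^ 2 / (1 + p.1) ^ 2) *
          ENNReal.ofReal (Q ^ 2 * (angularWeight α p.2 ^ 2 * Real.sin (2 * p.2) ^ (-gammaExp α))) := by
    intro p hp
    have hps : p ∈ strip := hp.1
    have hz1 : 1 ≤ p.1 := hp.2
    have hz : 0 < p.1 := hps.1
    have hθ : p.2 ∈ Ioo 0 (π / 2) := hps.2
    have hΓ : 0 ≤ angularWeight α p.2 := angularWeight_nonneg α (Ioo_subset_Icc_self hθ)
    have hsr : 0 ≤ Real.sin (2 * p.2) ^ (-gammaExp α) := Real.rpow_nonneg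
      (Real.sin_pos_of_pos_of_lt_pi (by linarith [hθ.1]) (by linarith [hθ.2])).le _
    rw [Real.enorm_eq_ofReal_abs, ← ENNReal.ofReal_pow (abs_nonneg _), sq_abs, tensor_apply,
      ← ENNReal.ofReal_mul (by positivity)]
    refine ENNReal.ofReal_le_ofReal ?_
    have hR := abs_le.1 (hCR p.1 hz)
    have hG := abs_le.1 (hQ p.2 hθ)
    have hRsq : (Dz₁^[j] (profileRadial α) p.1) ^ 2 ≤ (CR / (1 + p.1)) ^ 2 := sq_le_sq' hR.1 hR.2
    have hGsq : (Dθ₁^[i] (angularWeight α) p.2) ^ 2 ≤ (Q * angularWeight α p.2) ^ 2 :=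
      sq_le_sq' hG.1 hG.2
    have hwsq : radialWeight p.1 ^ 2 ≤ 16 := by
      have h4 := radialWeight_le_four hz1
      have h0 := (radialWeight_pos hz).le
      nlinarith
    have hω' := hω p hps
    calc (Dz₁^[j] (profileRadial α) p.1 * Dθ₁^[i] (angularWeight α) p.2 * ω p.1 p.2) ^ 2
        = (Dz₁^[j] (profileRadial α) p.1) ^ 2 * (Dθ₁^[i] (angularWeight α) p.2) ^ 2 *
            ω p.1 p.2 ^ 2 := by ring
      _ ≤ (CR / (1 + p.1)) ^ 2 * (Q * angularWeight α p.2) ^ 2 *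
            (radialWeight p.1 ^ 2 * Real.sin (2 * p.2) ^ (-gammaExp α)) := by
          apply mul_le_mul (mul_le_mul hRsq hGsq (sq_nonneg _) (sq_nonneg _)) hω' (sq_nonneg _)
          positivity
      _ ≤ (CR / (1 + p.1)) ^ 2 * (Q * angularWeight α p.2) ^ 2 *
            (16 * Real.sin (2 * p.2) ^ (-gammaExp α)) := by
          apply mul_le_mul_of_nonneg_left (mul_le_mul_of_nonneg_right hwsq hsr)
          positivity
      _ = 16 * CR ^ 2 / (1 + p.1) ^ 2 *
            (Q ^ 2 * (angularWeight α p.2 ^ 2 * Real.sin (2 * p.2) ^ (-gammaExp α))) := by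
          rw [div_pow]
          ring
  -- measurability of the two factors
  have hφm : AEMeasurable (fun z : ℝ => ENNReal.ofReal (16 * CR ^ 2 / (1 + z) ^ 2))
      (volume.restrict (Ici (1 : ℝ))) := by
    have : Measurable fun z : ℝ => 16 * CR ^ 2 / (1 + z) ^ 2 := by fun_prop
    exact this.ennreal_ofReal.aemeasurable
  have hψm : AEMeasurable (fun θ : ℝ =>
      ENNReal.ofReal (Q ^ 2 * (angularWeight α θ ^ 2 * Real.sin (2 * θ) ^ (-gammaExp α))))
      (volume.restrict (Ioo (0 : ℝ) (π / 2))) := by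
    have h1 : Measurable (angularWeight α) := (continuous_angularWeight hα.le).measurable
    have h2 : Measurable fun θ : ℝ => Real.sin (2 * θ) := by fun_prop
    exact (measurable_const.mul ((h1.pow_const 2).mul (h2.pow_const _))).ennreal_ofReal.aemeasurable
  -- the two one-dimensional integrals are finite
  have hφ : ∫⁻ z in Ici (1 : ℝ), ENNReal.ofReal (16 * CR ^ 2 / (1 + z) ^ 2) < ∞ := by
    have hsub' : Ici (1 : ℝ) ⊆ Ioi 0 := fun z hz => mem_Ioi.2 (lt_of_lt_of_le one_pos (mem_Ici.1 hz))
    have hC : (0 : ℝ) ≤ 16 * CR ^ 2 := by positivity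
    exact lt_of_le_of_lt (lintegral_mono_set hsub') (lintegral_Ioi_const_div_one_add_sq_lt_top hC)
  have hψ : ∫⁻ θ in Ioo (0 : ℝ) (π / 2),
      ENNReal.ofReal (Q ^ 2 * (angularWeight α θ ^ 2 * Real.sin (2 * θ) ^ (-gammaExp α))) < ∞ := by
    have e : ∀ θ : ℝ, ENNReal.ofReal (Q ^ 2 * (angularWeight α θ ^ 2 *
        Real.sin (2 * θ) ^ (-gammaExp α))) = ENNReal.ofReal (Q ^ 2) *
          ENNReal.ofReal (angularWeight α θ ^ 2 * Real.sin (2 * θ) ^ (-gammaExp α)) :=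
      fun θ => ENNReal.ofReal_mul (sq_nonneg _)
    simp_rw [e]
    rw [lintegral_const_mul' _ _ ENNReal.ofReal_ne_top]
    exact ENNReal.mul_lt_top ENNReal.ofReal_lt_top (lintegral_angularWeight_sq_mul_rpow_lt_top hα)
  have hsub : tailSet 1 ⊆ Ici (1 : ℝ) ×ˢ Ioo (0 : ℝ) (π / 2) := fun p hp => ⟨hp.2, hp.1.2⟩
  calc ∫⁻ p in tailSet 1,
        ‖tensor (Dz₁^[j] (profileRadial α)) (Dθ₁^[i] (angularWeight α)) p.1 p.2 * ω p.1 p.2‖ₑ ^ 2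
      ≤ ∫⁻ p in tailSet 1, ENNReal.ofReal (16 * CR ^ 2 / (1 + p.1) ^ 2) *
          ENNReal.ofReal (Q ^ 2 * (angularWeight α p.2 ^ 2 * Real.sin (2 * p.2) ^ (-gammaExp α))) :=
        setLIntegral_mono' (measurableSet_tailSet 1) hpt
    _ ≤ ∫⁻ p in Ici (1 : ℝ) ×ˢ Ioo (0 : ℝ) (π / 2), ENNReal.ofReal (16 * CR ^ 2 / (1 + p.1) ^ 2) *
          ENNReal.ofReal (Q ^ 2 * (angularWeight α p.2 ^ 2 * Real.sin (2 * p.2) ^ (-gammaExp α))) :=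
        lintegral_mono_set hsub
    _ = (∫⁻ z in Ici (1 : ℝ), ENNReal.ofReal (16 * CR ^ 2 / (1 + z) ^ 2)) *
          ∫⁻ θ in Ioo (0 : ℝ) (π / 2),
            ENNReal.ofReal (Q ^ 2 * (angularWeight α θ ^ 2 * Real.sin (2 * θ) ^ (-gammaExp α))) := by
        rw [Measure.volume_eq_prod, ← Measure.prod_restrict, lintegral_prod_mul hφm hψm]
    _ < ∞ := ENNReal.mul_lt_top hφ hψ

/-- The `𝓗⁰` weight qualifies: `(w/sin^{η/2}(2θ))² ≤ w² sin(2θ)^{−γ}` on the strip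
(`sin(2θ) ≤ 1` and `η = 99/100 ≤ γ = 1 + α/10`). [folklore] -/
theorem hWeight_sq_le {α : ℝ} (hα : 0 ≤ α) {p : ℝ × ℝ} (hp : p ∈ strip) :
    hWeight p.1 p.2 ^ 2 ≤ radialWeight p.1 ^ 2 * Real.sin (2 * p.2) ^ (-gammaExp α) := by
  have hs : 0 < Real.sin (2 * p.2) :=
    Real.sin_pos_of_pos_of_lt_pi (by linarith [hp.2.1]) (by linarith [hp.2.2])
  have hs1 : Real.sin (2 * p.2) ≤ 1 := Real.sin_le_one _
  unfold hWeight
  rw [div_pow, ← Real.rpow_natCast (Real.sin (2 * p.2) ^ (eta / 2)) 2, ← Real.rpow_mul hs.le,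
    div_eq_mul_inv, ← Real.rpow_neg hs.le]
  refine mul_le_mul_of_nonneg_left ?_ (sq_nonneg _)
  refine Real.rpow_le_rpow_of_exponent_ge hs hs1 ?_
  norm_num [eta, gammaExp]
  linarith

/-- The mixed weight qualifies with equality: `W² = w² sin(2θ)^{−γ}`. [folklore] -/
theorem totalWeight_sq_eq (α : ℝ) {p : ℝ × ℝ} (hp : p ∈ strip) :
    totalWeight α p.1 p.2 ^ 2 = radialWeight p.1 ^ 2 * Real.sin (2 * p.2) ^ (-gammaExp α) := by
  have hs : 0 < Real.sin (2 * p.2) :=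
    Real.sin_pos_of_pos_of_lt_pi (by linarith [hp.2.1]) (by linarith [hp.2.2])
  unfold totalWeight thetaWeight
  rw [mul_pow, ← Real.rpow_natCast (Real.sin (2 * p.2) ^ (-(gammaExp α / 2))) 2,
    ← Real.rpow_mul hs.le]
  congr 2
  norm_num

/-- **Finite `z ≥ 1` tails of the radial `𝓗⁴` terms of `F_*`** (any order `j`). [cite: ElgindiGhoulMasmoudi2021, §2.6 (p. 9 of arXiv:1910.14071)] -/
theorem lintegral_tailSet_one_hkRadialTerm_fundamentalProfile_lt_top {α : ℝ} (hα : 0 < α) (j : ℕ) :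
    ∫⁻ p in tailSet 1, ‖hkRadialTerm j (fundamentalProfile α) p.1 p.2‖ₑ ^ 2 < ∞ :=
  lintegral_tailSet_one_iterate_fundamentalProfile_lt_top hα 0 j fun _ hp => hWeight_sq_le hα.le hp

/-- **Finite `z ≥ 1` tails of the mixed `𝓗⁴` terms of `F_*`** (any orders `i, j`). [cite: ElgindiGhoulMasmoudi2021, §2.6 (p. 9 of arXiv:1910.14071)] -/
theorem lintegral_tailSet_one_hkMixedTerm_fundamentalProfile_lt_top {α : ℝ} (hα : 0 < α)
    (i j : ℕ) : ∫⁻ p in tailSet 1, ‖hkMixedTerm α i j (fundamentalProfile α) p.1 p.2‖ₑ ^ 2 < ∞ :=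
  lintegral_tailSet_one_iterate_fundamentalProfile_lt_top hα i j fun _ hp =>
    (totalWeight_sq_eq α hp).le

end Elgindi

end Literature.Analysis.FluidPDE
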